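import Literature.AlgebraicGeometry.Motives.AbelianVarietyIsogenyPushforwardLocallyFree
import Literature.AlgebraicGeometry.Modules.PushforwardFiniteLocallyFree
import Literature.NumberTheory.DiophantineGeometry.AVIsogenyFlat
import HarnessLib

/-!
# The direct image of a vector bundle along an isogeny is a vector bundle — PROVED

This file DISCHARGES the named fact `Literature.AlgebraicGeometry.Motives.IsogenyPushforwardFiniteLocallyFree`
(`Motives/AbelianVarietyIsogenyPushforwardLocallyFree`; Görtz–Wedhorn I Prop. 12.13 with Prop. 12.19, the statement
S. Mukai (1978) §5 computes with): for an isogeny `g : A → B` of abelian varieties over ANY field `k` and a finite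
locally free `𝒪_A`-module `F`, the direct image `g_*F` is a finite locally free `𝒪_B`-module — unconditionally, over
every field (no characteristic hypothesis).

Proof (piece (B) of the Hodge road's THEOREM T, seat core-B of director-hodge R14.24): an isogeny is finite (by
definition, `AbelianVariety.IsIsogeny` = surjective ∧ finite) and FLAT — the tree's theorem
`AbelianVariety.IsIsogeny.flat` (`Literature/NumberTheory/DiophantineGeometry/AVIsogenyFlat`, Görtz–Wedhorn II
Prop. 27.54 via constant fibre rank over a reduced base, valid over every field); `B` is locally noetherian (of
finite type over a field, Mathlib `LocallyOfFiniteType.isLocallyNoetherian`); and the direct image of a finite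
locally free module along a finite flat morphism onto a locally noetherian scheme is finite locally free
(`IsFiniteLocallyFree.pushforward_of_isFinite_of_flat`, `Modules/PushforwardFiniteLocallyFree`: affine-locally,
finite projective sections over the finite flat = finite projective algebra `Γ(A, g⁻¹V)` are finite projective over
`Γ(B, V)`, Görtz–Wedhorn I Cor. 7.42 and Stacks 00NX).

* `IsFiniteLocallyFree.pushforward_isogeny` — `g_*F` is finite locally free (instance-free form);
* `isogenyPushforwardFiniteLocallyFree_holds : IsogenyPushforwardFiniteLocallyFree` — the discharge.

Everything is proved; no named facts are used. Nothing here concerns the rank statement `rk(g_*F) = deg g · rk F`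
(see the TODO of `Modules/PushforwardFiniteLocallyFree`).

## References

* U. Görtz, T. Wedhorn, *Algebraic Geometry I: Schemes*, 2nd ed. (2020), Prop. 12.13 (p. 410), Prop. 12.19
  (p. 413). [GortzWedhorn2020]
* U. Görtz, T. Wedhorn, *Algebraic Geometry II* (2023), Prop. 27.54, Cor. 27.177 (1). [GortzWedhorn2023]
* D. Mumford, *Abelian Varieties* (1970), §7 Application 3 (p. 63). [MumfordAV1970]
* S. Mukai, *Semi-homogeneous vector bundles on an abelian variety*, J. Math. Kyoto Univ. 18 (1978), §5
  Prop. 5.4 (1) (p. 259). [Mukai1978]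
-/

noncomputable section

open CategoryTheory CategoryTheory.Limits AlgebraicGeometry

universe u

namespace Literature.AlgebraicGeometry.Motives

open AbelianVariety

/-- **The direct image of a vector bundle along an isogeny is a vector bundle** (Görtz–Wedhorn I Prop. 12.13 with
Prop. 12.19, for the finite flat morphism `g`): for an isogeny `g : A → B` of abelian varieties over a field `k` and
a finite locally free `𝒪_A`-module `F`, `g_*F` is a finite locally free `𝒪_B`-module. `g` is finite
(`IsIsogeny` = surjective ∧ finite) and flat (`IsIsogeny.flat`, Görtz–Wedhorn II Prop. 27.54), `B` is locally
noetherian (Mathlib `LocallyOfFiniteType.isLocallyNoetherian`); apply `IsFiniteLocallyFree.pushforward_of_isFinite_of_flat`.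
[cite: GortzWedhorn2020, Prop. 12.13 (p. 410) with Prop. 12.19 (p. 413)] -/
theorem IsFiniteLocallyFree.pushforward_isogeny {k : Type u} [Field k] {A B : AbelianVariety k}
    {g : A ⟶ B} (hg : IsIsogeny g) {F : A.X.left.Modules} (hF : IsFiniteLocallyFree F) :
    IsFiniteLocallyFree ((Scheme.Modules.pushforward (Hom.toSchemeHom g)).obj F) := by
  haveI : IsFinite (Hom.toSchemeHom g) := hg.2
  haveI : Flat (Hom.toSchemeHom g) := hg.flat
  -- `B` is locally noetherian: locally of finite type (proper) over the noetherian scheme `Spec k`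
  haveI : IsLocallyNoetherian B.X.left := LocallyOfFiniteType.isLocallyNoetherian B.X.hom
  exact hF.pushforward_of_isFinite_of_flat (Hom.toSchemeHom g)

/-- **PIECE (B) DISCHARGED: `IsogenyPushforwardFiniteLocallyFree` holds** — for every field `k`, every isogeny
`g : A → B` of abelian varieties over `k` and every finite locally free `𝒪_A`-module `F`, the direct image `g_*F`
(Mathlib's `Scheme.Modules.pushforward` of the underlying scheme morphism) is finite locally free
(`IsFiniteLocallyFree.pushforward_isogeny`). Unconditional; no characteristic hypothesis.
[cite: GortzWedhorn2020, Prop. 12.13 (p. 410) with Prop. 12.19 (p. 413)] -/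
theorem isogenyPushforwardFiniteLocallyFree_holds : IsogenyPushforwardFiniteLocallyFree.{u} :=
  fun _k _ _A _B _g hg _F hF => hF.pushforward_isogeny hg

end Literature.AlgebraicGeometry.Motives

end
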